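import Summits.ResolutionOfSingularities.ResolutionOfSingularities.Theorems.EquisingularLiftEquisingularLiftNatRatLiftSaturatedData
import Summits.ResolutionOfSingularities.ResolutionOfSingularities.Theorems.EquisingularLiftEquisingularLiftNatSaturatedLift
import Summits.ResolutionOfSingularities.ResolutionOfSingularities.Theorems.EquisingularLiftEquisingularLiftNatLiftableNoseClassDefs
import Mathlib
import HarnessLib

/-!
# [OURS · L1 W4.5(b) · EL♮(3)] T-RATLIFT-ALG, PART 5 — COMPOSITION «RatLift ∘ SatLift»: images of `ℙ(τ)_k` under forms of one degree
# (cofinite clause) with regular trace are LIFTABLE CENTRES — the engine of the `rat` constructor of the successor liftable nose class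
# (crux `EquisingularLiftNatThree` = stmt-ResolutionOfSingularities-20148, parent stmt-20038, line `sections`; res-L1-w45b-lead-2
# RESHAPE v11 / child v8 «LIFTABLE NOSE CLASS» 2026-08-27T12:22:39Z: «res-type-032 (RatLift ring core → successor constructor `rat`)»;
# res-L1-w45b-plan-1 PLANNER-MEMO-g10-1 object O1)

NOT a statement of any manuscript. Helper file of the chain res-L1-w45b (cell `res-hironaka`, rung L, slot W4.5(b));
OURS; AI-written, weaker than expert review; def-free, no `sorry`, standard axioms; filed
`--supports stmt-ResolutionOfSingularities-20148 --as helper` (counted 0, registers nothing).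

* **`isLiftableCentre_of_forms`** — `k` a perfect field, `n : ℕ`, `f : Fin (n+1) → k[x_τ]` forms of one degree `e ≥ 1` (`τ` finite)
  satisfying the COFINITE CLAUSE in all degrees `m ≥ m₀`; `Z ⊆ ℙⁿ_k` the zero set of `𝔭 := ker (aeval f)` (`y ∈ Z ↔ 𝔭 ≤ 𝔮_y`),
  closed, with `V(𝓘_Z)` a REGULAR scheme. THEN `IsLiftableCentre k n Z hZ` (lead-2's `…NatLiftableNoseClassDefs`, = the hLIFT clause
  of `elnat_noseThenPoints_of_liftableCentre` p525611): for every complete DVR `O ↠ k` with algebraically closed residue field there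
  is an `O`-smooth centre with exact trace `𝓘_Z`. Proof = part 3 `RatLift.exists_saturatedLift` (any DVR, any irreducible `ϖ`) fed
  into res-type-051's `SatLift.liftableCentre_of_saturatedLift` (p530902) with `𝔭 = ⟨ker (aeval f), isHomogeneous_ker_aeval⟩`,
  radical because prime.
* `isLiftableCentre_of_forms_fin_two` — parameters `ℙ¹` (`τ = Fin 2`): the clause in ONE degree `m₀ ≥ 1` plus `s^e, t^e` in the
  span of the `f i` suffice (part 2 `clause_of_le`).
* `isClosed_setOf_ideal_le` / **`isLiftableCentre_setOf_forms`** — the `Z`-literal form: `Z := {y | ker (aeval f) ≤ 𝔮_y}` (closed by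
  Mathlib's `ProjectiveSpectrum.isClosed_zeroLocus`), hypotheses = clause + regularity only.
* the specimens (smooth rational quartic and every monomial curve `C_e`, part 4 `quartic_clause` / `monomialCurve_clause`) are composed in
  the follow-up file `…RatLiftMonomialCurvesLiftable`.

What is NOT here: the regularity input `hZreg` — DISCHARGED FROM THE CLAUSE ITSELF by res-type-051's T-RATREG
`RatReg.isRegular_subscheme_vanishingIdeal_of_clause'` (`…NatRatLiftRegular`, p534148; chartwise `(k[x]_{x_i})₀/𝔭 ≅ (k[s]_{f_i})₀`,
open pieces of `ℙ^r` are regular), so that the successor `rat` constructor carries purely algebraic downstairs data (the unconditional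
specimens are in `…RatLiftMonomialCurvesLiftable`); the successor inductive class and the re-derivation of
`stub_elnat_liftableNoseThenPoints` (the successor lead's / 051's pen).

References: cell — res-type-051 `SatLift.liftableCentre_of_saturatedLift` (p530902), lead-2 `IsLiftableCentre` (p530164),
parts 1–3 of this series (p530115, p531171, p532753); all OURS.
-/

set_option linter.dupNamespace false -- mandated namespace `Summit.<Summit>.<Problem>` of this single-conjunct summit

noncomputable section

open CategoryTheory AlgebraicGeometry TopologicalSpace
open MvPolynomial
open Literature.AlgebraicGeometry.Resolution

namespace Summit.ResolutionOfSingularities.ResolutionOfSingularities.Cruxes.EquisingularLiftNat.Sections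

namespace RatLift

/-- **IMAGES OF `ℙ(τ)` UNDER FORMS WITH REGULAR TRACE ARE LIFTABLE CENTRES** («RatLift ∘ SatLift»). `k` perfect, `f : Fin (n+1) → k[x_τ]`
forms of one degree `e ≥ 1` with the cofinite clause in all degrees `m ≥ m₀`, `Z = {y | ker (aeval f) ≤ 𝔮_y}` closed with `V(𝓘_Z)`
regular ⟹ `IsLiftableCentre k n Z hZ`. [OURS · L1 W4.5b; folklore inputs] -/
theorem isLiftableCentre_of_forms (k : Type) [Field k] [PerfectField k] (n : ℕ) {τ : Type} [Finite τ]
    (f : Fin (n + 1) → MvPolynomial τ k) {e : ℕ} (he : 0 < e) (hf : ∀ i, (f i).IsHomogeneous e) {m₀ : ℕ}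
    (hcl : ∀ m, m₀ ≤ m →
      homogeneousSubmodule τ k (e * m) ≤ (homogeneousSubmodule (Fin (n + 1)) k m).map (aeval (R := k) f).toLinearMap)
    (Z : Set (Literature.AlgebraicGeometry.Motives.projectiveSpace n k).left) (hZ : IsClosed Z)
    (hZ𝔭 : letI := MvPolynomial.gradedAlgebra (σ := Fin (n + 1)) (R := k)
      Z = {y : Proj (homogeneousSubmodule (Fin (n + 1)) k) |
        RingHom.ker (aeval (R := k) f) ≤ (y : ProjectiveSpectrum (homogeneousSubmodule (Fin (n + 1)) k)).asHomogeneousIdeal.toIdeal})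
    (hZreg : Scheme.IsRegular (Scheme.IdealSheafData.vanishingIdeal
      (⟨Z, hZ⟩ : Closeds (Literature.AlgebraicGeometry.Motives.projectiveSpace n k).left)).subscheme) :
    IsLiftableCentre k n Z hZ := by
  letI := MvPolynomial.gradedAlgebra (σ := Fin (n + 1)) (R := k)
  intro O _ _ _ _ _ π hπ
  letI := MvPolynomial.gradedAlgebra (σ := Fin (n + 1)) (R := O)
  obtain ⟨ϖ, hϖ⟩ := IsDiscreteValuationRing.exists_irreducible O
  obtain ⟨c, Gt, D, hGt, hsat, hle, hred⟩ := exists_saturatedLift π hπ ϖ hϖ f he hf hcl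
  let 𝔭 : HomogeneousIdeal (homogeneousSubmodule (Fin (n + 1)) k) :=
    ⟨RingHom.ker (aeval (R := k) f), isHomogeneous_ker_aeval f hf he⟩
  obtain ⟨hsm, htr⟩ := SatLift.liftableCentre_of_saturatedLift π hπ ϖ hϖ Gt D hGt hsat 𝔭 (isRadical_ker_aeval f)
    hle m₀ hred Z hZ hZ𝔭 hZreg
  exact ⟨_, hsm, htr⟩

/-- **Parameters `ℙ¹` (`τ = Fin 2`), one-degree form.** If `s^e` and `t^e` lie in the span of the `f i` and the cofinite clause holds
in ONE degree `m₀ ≥ 1`, a regular trace `Z = V₊(ker (aeval f))` is a liftable centre. [OURS · L1 W4.5b] -/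
theorem isLiftableCentre_of_forms_fin_two (k : Type) [Field k] [PerfectField k] (n : ℕ)
    (f : Fin (n + 1) → MvPolynomial (Fin 2) k) {e : ℕ} (he : 0 < e) (hf : ∀ i, (f i).IsHomogeneous e)
    (hs : X 0 ^ e ∈ (homogeneousSubmodule (Fin (n + 1)) k 1).map (aeval (R := k) f).toLinearMap)
    (ht : X 1 ^ e ∈ (homogeneousSubmodule (Fin (n + 1)) k 1).map (aeval (R := k) f).toLinearMap) {m₀ : ℕ} (hm₀ : 1 ≤ m₀)
    (hcl : homogeneousSubmodule (Fin 2) k (e * m₀) ≤ (homogeneousSubmodule (Fin (n + 1)) k m₀).map (aeval (R := k) f).toLinearMap)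
    (Z : Set (Literature.AlgebraicGeometry.Motives.projectiveSpace n k).left) (hZ : IsClosed Z)
    (hZ𝔭 : letI := MvPolynomial.gradedAlgebra (σ := Fin (n + 1)) (R := k)
      Z = {y : Proj (homogeneousSubmodule (Fin (n + 1)) k) |
        RingHom.ker (aeval (R := k) f) ≤ (y : ProjectiveSpectrum (homogeneousSubmodule (Fin (n + 1)) k)).asHomogeneousIdeal.toIdeal})
    (hZreg : Scheme.IsRegular (Scheme.IdealSheafData.vanishingIdeal
      (⟨Z, hZ⟩ : Closeds (Literature.AlgebraicGeometry.Motives.projectiveSpace n k).left)).subscheme) :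
    IsLiftableCentre k n Z hZ :=
  isLiftableCentre_of_forms k n f he hf (clause_of_le f hs ht hm₀ hcl) Z hZ hZ𝔭 hZreg


/-- The zero set `{y | I ≤ 𝔮_y}` of an ideal is closed in `ℙⁿ_k` (Mathlib `ProjectiveSpectrum.isClosed_zeroLocus`, restated on the
carrier of `Proj`). [folklore] [OURS · L1 W4.5b] -/
theorem isClosed_setOf_ideal_le (k : Type) [Field k] (n : ℕ) (I : Ideal (MvPolynomial (Fin (n + 1)) k)) :
    letI := MvPolynomial.gradedAlgebra (σ := Fin (n + 1)) (R := k)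
    IsClosed {y : Proj (homogeneousSubmodule (Fin (n + 1)) k) |
      I ≤ (y : ProjectiveSpectrum (homogeneousSubmodule (Fin (n + 1)) k)).asHomogeneousIdeal.toIdeal} := by
  letI := MvPolynomial.gradedAlgebra (σ := Fin (n + 1)) (R := k)
  exact ProjectiveSpectrum.isClosed_zeroLocus (homogeneousSubmodule (Fin (n + 1)) k) (I : Set (MvPolynomial (Fin (n + 1)) k))

/-- **`Z` literal form** of `isLiftableCentre_of_forms`: the centre IS the zero set `{y | ker (aeval f) ≤ 𝔮_y}` (closed by
`isClosed_setOf_ideal_le`); only the clause and the regularity of `V(𝓘_Z)` remain as hypotheses — the shape of a `rat` constructor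
carrying purely algebraic downstairs data (res-type-051 DESIGN INPUT 2026-08-27T12:56:42Z). [OURS · L1 W4.5b] -/
theorem isLiftableCentre_setOf_forms (k : Type) [Field k] [PerfectField k] (n : ℕ) {τ : Type} [Finite τ]
    (f : Fin (n + 1) → MvPolynomial τ k) {e : ℕ} (he : 0 < e) (hf : ∀ i, (f i).IsHomogeneous e) {m₀ : ℕ}
    (hcl : ∀ m, m₀ ≤ m →
      homogeneousSubmodule τ k (e * m) ≤ (homogeneousSubmodule (Fin (n + 1)) k m).map (aeval (R := k) f).toLinearMap)
    (hZreg : letI := MvPolynomial.gradedAlgebra (σ := Fin (n + 1)) (R := k)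
      Scheme.IsRegular (Scheme.IdealSheafData.vanishingIdeal
        (⟨{y : Proj (homogeneousSubmodule (Fin (n + 1)) k) |
            RingHom.ker (aeval (R := k) f) ≤ (y : ProjectiveSpectrum (homogeneousSubmodule (Fin (n + 1)) k)).asHomogeneousIdeal.toIdeal},
          isClosed_setOf_ideal_le k n _⟩ : Closeds (Literature.AlgebraicGeometry.Motives.projectiveSpace n k).left)).subscheme) :
    letI := MvPolynomial.gradedAlgebra (σ := Fin (n + 1)) (R := k)
    IsLiftableCentre k n
      {y : Proj (homogeneousSubmodule (Fin (n + 1)) k) |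
        RingHom.ker (aeval (R := k) f) ≤ (y : ProjectiveSpectrum (homogeneousSubmodule (Fin (n + 1)) k)).asHomogeneousIdeal.toIdeal}
      (isClosed_setOf_ideal_le k n _) :=
  isLiftableCentre_of_forms k n f he hf hcl _ _ rfl hZreg

end RatLift

end Summit.ResolutionOfSingularities.ResolutionOfSingularities.Cruxes.EquisingularLiftNat.Sections

end
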